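import Mathlib.RingTheory.PowerSeries.Binomial
import Mathlib.NumberTheory.Padics.PadicVal.Basic
import Mathlib.Data.Nat.Factorial.BigOperators
import Mathlib.Data.ZMod.Basic
import Mathlib.RingTheory.Coprime.Lemmas
import Mathlib.Tactic.LinearCombination
import Mathlib.Tactic.Positivity
import Mathlib.Tactic.FieldSimp
import Mathlib.Tactic.Ring
import HarnessLib

/-!
# The power series `(1 - ζ_p T)^{θ/q}` of the plus argument [Schoof2009, Proposition 12.1 (i), (ii)]

[Schoof2009, Chapter 12] ("The plus argument I") proves Mihăilescu's theorem that for a non-zero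
solution of Catalan's equation `x^p - y^q = 1` (`p, q ≥ 7`) the plus part `(x - ζ_p)^{1+ι}` generates
a free `𝔽_q[G⁺]`-module in the obstruction group ([Schoof2009, Theorem 12.4]) by Runge's method
applied to the power series
`F(T) = (1 - ζ_p T)^{θ/q} = ∏_σ (1 - σ(ζ_p) T)^{n_σ/q} ∈ ℚ(ζ_p)⟦T⟧`, `θ = ∑_σ n_σ σ ∈ ℤ[G]`.
This file is the *formal* part of [Schoof2009, Proposition 12.1] about `F(T)`, for an arbitrary
field `K` of characteristic zero, a coefficient ring `R → K` and arbitrary "conjugates" `a_i ∈ R`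
in place of `-σ(ζ_p)`: with `F = ∏_{i ∈ s} (1 + a_i T)^{n_i/q}`
(`PowerSeries.binomialSeries`, rescaled),

* `Catalan.Plus.prod_rescale_binomialSeries_pow` — `F(T)^q = ∏_i (1 + a_i T)^{n_i}`;
* `Catalan.Plus.intOutside_prod_rescale_binomialSeries` — [Schoof2009, Prop. 12.1 (i)] in the
  quantitative form `q^{k + ord_q(k!)} · [T^k] F ∈ R` ([Schoof2009, Exercise 5.7]);
* `Catalan.Plus.expCong_prod_rescale_binomialSeries` — [Schoof2009, Prop. 12.1 (ii)]:
  `k! q^k · [T^k] F = c_k ∈ R` with `c_k ≡ (∑_i n_i a_i)^k (mod q R)` ([Schoof2009, Exercise 12.2]).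

This is the first of the files formalising [Schoof2009, Chapter 12] (programme: formal series —
this file; evaluation and the tail estimate [Schoof2009, Prop. 12.1 (iii), 12.2]; the Runge
argument [Schoof2009, Lemma 12.3, Theorem 12.4]). Everything is proved; no definitions.

## References

* R. Schoof, *Catalan's Conjecture*, Universitext, Springer 2009 [Schoof2009], Proposition 12.1,
  Exercises 5.7, 12.2 (book pp. 77–78, 32, 84) — held, `lit read book:schoof2009-catalan-s-conjecture`
  (PDF pp. 157–158, 163).
* P. Mihăilescu, *Primary cyclotomic units and a proof of Catalan's conjecture*, J. reine angew.
  Math. **572** (2004), 167–195 [Mihailescu2004].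
-/

namespace Literature.NumberTheory.DiophantineGeometry

namespace Catalan.Plus

open Finset PowerSeries

open scoped Nat

/-! ### Binomial coefficients `C(n/q, k)`: `∏_{j<k} (n - jq) = k! q^k C(n/q, k)` and `ord_q` -/

/-- **[Schoof2009, Exercise 5.7]** (integrality of `C(n/q, k)` outside `q`, quantitative form):
for a prime `q` and natural numbers `n, k`, writing `k! = q^e K'` with `e = ord_q(k!)`, the integer
`K'` divides `N_k = ∏_{j<k} (n - j q)`, i.e. `k! u = q^e N_k` for some `u ∈ ℤ` (so that
`C(n/q, k) = N_k/(q^k k!) = u/q^(k+e)`). Proof: `q` is invertible modulo `K'`; choosing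
`r ≡ n/q (mod K')`, `r ≥ k`, one has `N_k ≡ q^k r (r-1) ⋯ (r-k+1) ≡ 0 (mod K')` because `k!`
divides a product of `k` consecutive integers. [cite: Schoof2009, Exercise 5.7] -/
theorem exists_factorial_mul_eq {q : ℕ} (hq : q.Prime) (n k : ℕ) :
    ∃ u : ℤ, (k ! : ℤ) * u = (q : ℤ) ^ (padicValNat q k !) * ∏ j ∈ range k, ((n : ℤ) - j * q) := by
  haveI := Fact.mk hq
  set e := padicValNat q k ! with he
  set Nk := ∏ j ∈ range k, ((n : ℤ) - j * q) with hNk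
  -- `k! = q^e K'` with `q ∤ K'`
  obtain ⟨K', hK⟩ : q ^ e ∣ k ! := pow_padicValNat_dvd
  have hqK : ¬ q ∣ K' := by
    intro hd
    have : q ^ (e + 1) ∣ k ! := by rw [hK, pow_succ]; exact mul_dvd_mul_left _ hd
    exact pow_succ_padicValNat_not_dvd (Nat.factorial_ne_zero k) this
  have hK0 : K' ≠ 0 := by
    rintro rfl
    exact Nat.factorial_ne_zero k (by simpa using hK)
  -- `r ≡ n/q (mod K')` with `r ≥ k`
  have hcop : IsCoprime (q : ℤ) (K' : ℤ) :=
    Nat.isCoprime_iff_coprime.mpr ((Nat.Prime.coprime_iff_not_dvd hq).mpr hqK)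
  obtain ⟨c, d, hcd⟩ := hcop
  obtain ⟨r, hrk, hKr⟩ : ∃ r : ℕ, k ≤ r ∧ (K' : ℤ) ∣ q * r - n := by
    set R : ℤ := c * n + K' * (|c| * n + k) with hR
    have hK1 : (1 : ℤ) ≤ K' := by exact_mod_cast Nat.one_le_iff_ne_zero.mpr hK0
    have hR0 : (k : ℤ) ≤ R := by
      have hc : -(|c| * (n : ℤ)) ≤ c * n := by
        have := neg_abs_le (c * (n : ℤ))
        rwa [abs_mul, Nat.abs_cast] at this
      have hcn : 0 ≤ |c| * (n : ℤ) := by positivity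
      rw [hR]
      nlinarith
    refine ⟨R.toNat, by omega, ?_⟩
    rw [Int.toNat_of_nonneg (by omega), hR]
    exact ⟨q * (|c| * n + k) - d * n, by linear_combination (n : ℤ) * hcd⟩
  -- `K' ∣ N_k`
  haveI : NeZero K' := ⟨hK0⟩
  have hKN : (K' : ℤ) ∣ Nk := by
    rw [← ZMod.intCast_zmod_eq_zero_iff_dvd, hNk, Int.cast_prod]
    have hnr : ((n : ℤ) : ZMod K') = (q : ℤ) * (r : ℤ) := by
      have := (ZMod.intCast_zmod_eq_zero_iff_dvd _ K').mpr hKr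
      push_cast at this ⊢
      linear_combination -this
    have hterm : ∀ j ∈ range k, (((n : ℤ) - j * q : ℤ) : ZMod K') =
        ((q : ℤ) : ZMod K') * (((r - j : ℕ) : ℤ) : ZMod K') := by
      intro j hj
      have hjr : j ≤ r := (mem_range.mp hj).le.trans hrk
      push_cast [hjr]
      rw [show ((n : ℕ) : ZMod K') = ((n : ℤ) : ZMod K') by norm_cast, hnr]
      push_cast
      ring
    rw [prod_congr rfl hterm, prod_mul_distrib, prod_const, card_range]
    have hdesc : ∏ j ∈ range k, (((r - j : ℕ) : ℤ) : ZMod K') =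
        ((r.descFactorial k : ℕ) : ZMod K') := by
      rw [Nat.descFactorial_eq_prod_range]
      push_cast
      rfl
    rw [hdesc]
    have : ((r.descFactorial k : ℕ) : ZMod K') = 0 := by
      rw [ZMod.natCast_eq_zero_iff]
      exact (Dvd.intro_left _ hK.symm).trans (Nat.factorial_dvd_descFactorial r k)
    rw [this, mul_zero]
  obtain ⟨u, hu⟩ := hKN
  refine ⟨u, ?_⟩
  rw [hu, hK]
  push_cast
  ring

/-- `∏_{j<k} (n - j q) ≡ n^k (mod q)` in any commutative ring. [folklore] -/
theorem dvd_prod_range_sub_mul_sub_pow {A : Type*} [CommRing A] (n q : A) (k : ℕ) :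
    q ∣ ∏ j ∈ range k, (n - j * q) - n ^ k := by
  induction k with
  | zero => simp
  | succ k ih =>
    obtain ⟨c, hc⟩ := ih
    refine ⟨c * (n - k * q) - n ^ k * k, ?_⟩
    rw [prod_range_succ, pow_succ]
    linear_combination (n - k * q) * hc

variable {K : Type*} [Field K] [CharZero K]

/-- `C(a, k) = (∏_{j<k} (a - j))/k!` in a field of characteristic zero (Mathlib's `Ring.choose`).
[folklore] -/
theorem ring_choose_eq_prod_div_factorial (a : K) (k : ℕ) :
    Ring.choose a k = (∏ j ∈ range k, (a - j)) / k ! := by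
  rw [Ring.choose_eq_smul, ← Polynomial.aeval_eq_smeval, Polynomial.aeval_def,
    Polynomial.eval₂_eq_eval_map, descPochhammer_map, descPochhammer_eval_eq_prod_range,
    smul_eq_mul, div_eq_inv_mul]

/-- `k! q^k C(n/q, k) = ∏_{j<k} (n - j q)`. [cite: Schoof2009, Proposition 12.1 (proof of (ii))] -/
theorem factorial_mul_pow_mul_choose (n : K) {q : K} (hq : q ≠ 0) (k : ℕ) :
    (k ! : K) * q ^ k * Ring.choose (n / q) k = ∏ j ∈ range k, (n - j * q) := by
  rw [ring_choose_eq_prod_div_factorial, ← card_range k, ← prod_const, card_range,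
    mul_div_assoc', mul_assoc, ← prod_mul_distrib,
    mul_div_cancel_left₀ _ (Nat.cast_ne_zero.mpr (Nat.factorial_ne_zero k))]
  refine prod_congr rfl fun j _ => ?_
  field_simp

/-! ### The series `∏_i (1 + a_i T)^{n_i/q}` and its `q`-th power -/

/-- Coefficients of a rescaled binomial series: `[T^k] (1 + aT)^r = a^k C(r, k)`. [folklore] -/
theorem coeff_rescale_binomialSeries (a r : K) (k : ℕ) :
    coeff k (rescale a (binomialSeries K r)) = a ^ k * Ring.choose r k := by
  rw [coeff_rescale, binomialSeries_coeff, smul_eq_mul, mul_one]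

/-- `((1+T)^r)^j = (1+T)^{jr}`. [folklore] -/
theorem binomialSeries_pow (r : K) (j : ℕ) :
    binomialSeries K r ^ j = binomialSeries K ((j : K) * r) := by
  induction j with
  | zero => rw [pow_zero, Nat.cast_zero, zero_mul, binomialSeries_zero]
  | succ j ih => rw [pow_succ, ih, ← binomialSeries_add, Nat.cast_succ, add_mul, one_mul]

/-- `((1 + aT)^{n/q})^q = (1 + aT)^n`. [cite: Schoof2009, Chapter 12 (p. 77)] -/
theorem rescale_binomialSeries_pow_eq {q : ℕ} (hq : q ≠ 0) (a : K) (n : ℕ) :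
    rescale a (binomialSeries K ((n : K) / q)) ^ q = (1 + C a * X) ^ n := by
  have h1 : (q : K) * ((n : K) / q) = n := by
    field_simp
  rw [← map_pow, binomialSeries_pow, h1, binomialSeries_nat, map_pow, map_add, map_one, rescale_X]

/-- **`F(T)^q = (1 - ζ_p T)^θ`**: `(∏_i (1 + a_i T)^{n_i/q})^q = ∏_i (1 + a_i T)^{n_i}`.
[cite: Schoof2009, Chapter 12 (p. 77), Proposition 12.2 (ii)] -/
theorem prod_rescale_binomialSeries_pow {ι : Type*} (s : Finset ι) {q : ℕ} (hq : q ≠ 0)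
    (a : ι → K) (n : ι → ℕ) :
    (∏ i ∈ s, rescale (a i) (binomialSeries K ((n i : K) / q))) ^ q =
      ∏ i ∈ s, (1 + C (a i) * X) ^ (n i) := by
  rw [← prod_pow]
  exact prod_congr rfl fun i _ => rescale_binomialSeries_pow_eq hq _ _

/-! ### [Schoof2009, Proposition 12.1 (i)]: the coefficients are integral outside `q` -/

section Integrality

variable {R : Type*} [CommRing R] [Algebra R K]

omit [CharZero K] in
/-- The constant series `1` has coefficients integral outside `q` (trivially). [folklore] -/
theorem intOutside_one (q : ℕ) :
    ∀ k, ∃ y : R, algebraMap R K y = (q : K) ^ (k + padicValNat q k !) * coeff k (1 : K⟦X⟧) := by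
  intro k
  rcases Nat.eq_zero_or_pos k with rfl | hk
  · exact ⟨1, by simp⟩
  · exact ⟨0, by simp [coeff_one, hk.ne']⟩

omit [CharZero K] in
/-- Integrality outside `q` (in the form `q^{k + ord_q(k!)} [T^k] S ∈ R`) is stable under products;
the point is `ord_q(i!) + ord_q(j!) ≤ ord_q((i+j)!)`. [cite: Schoof2009, Proposition 12.1 (i)] -/
theorem intOutside_mul {q : ℕ} [hq : Fact q.Prime] {S T : K⟦X⟧}
    (hS : ∀ k, ∃ y : R, algebraMap R K y = (q : K) ^ (k + padicValNat q k !) * coeff k S)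
    (hT : ∀ k, ∃ y : R, algebraMap R K y = (q : K) ^ (k + padicValNat q k !) * coeff k T) :
    ∀ k, ∃ y : R, algebraMap R K y = (q : K) ^ (k + padicValNat q k !) * coeff k (S * T) := by
  intro k
  choose yS hyS using hS
  choose yT hyT using hT
  have hv : ∀ ij ∈ antidiagonal k,
      padicValNat q ij.1 ! + padicValNat q ij.2 ! ≤ padicValNat q k ! := by
    intro ij hij
    have hk : ij.1 + ij.2 = k := mem_antidiagonal.mp hij
    have hdvd : ij.1 ! * ij.2 ! ∣ k ! := hk ▸ Nat.factorial_mul_factorial_dvd_factorial_add _ _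
    rw [← padicValNat.mul (Nat.factorial_ne_zero _) (Nat.factorial_ne_zero _)]
    exact (padicValNat_dvd_iff_le (Nat.factorial_ne_zero k)).mp (pow_padicValNat_dvd.trans hdvd)
  refine ⟨∑ ij ∈ antidiagonal k, (q : R) ^ (padicValNat q k ! -
      (padicValNat q ij.1 ! + padicValNat q ij.2 !)) * (yS ij.1 * yT ij.2), ?_⟩
  rw [coeff_mul, mul_sum, map_sum]
  refine sum_congr rfl fun ij hij => ?_
  have hk : ij.1 + ij.2 = k := mem_antidiagonal.mp hij
  obtain ⟨d, hd⟩ := Nat.exists_eq_add_of_le (hv ij hij)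
  rw [map_mul, map_mul, map_pow, map_natCast, hyS, hyT, hd, Nat.add_sub_cancel_left, ← hk]
  ring

omit [CharZero K] in
/-- Integrality outside `q` for finite products. [cite: Schoof2009, Proposition 12.1 (i)] -/
theorem intOutside_prod {q : ℕ} [hq : Fact q.Prime] {ι : Type*} (s : Finset ι) (S : ι → K⟦X⟧)
    (hS : ∀ i ∈ s, ∀ k, ∃ y : R,
      algebraMap R K y = (q : K) ^ (k + padicValNat q k !) * coeff k (S i)) :
    ∀ k, ∃ y : R, algebraMap R K y = (q : K) ^ (k + padicValNat q k !) * coeff k (∏ i ∈ s, S i) := by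
  classical
  induction s using Finset.induction_on with
  | empty => rw [prod_empty]; exact intOutside_one q
  | insert i s hi ih =>
    rw [prod_insert hi]
    exact intOutside_mul (hS i (mem_insert_self i s)) (ih fun j hj => hS j (mem_insert_of_mem hj))

/-- **[Schoof2009, Proposition 12.1 (i)] for one factor**: `q^{k + ord_q(k!)} [T^k] (1 + wT)^{n/q}`
`= u w^k ∈ R` (`u ∈ ℤ` from [Schoof2009, Exercise 5.7]). [cite: Schoof2009, Proposition 12.1 (i)] -/
theorem intOutside_rescale_binomialSeries {q : ℕ} [hq : Fact q.Prime] (w : R) (n : ℕ) :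
    ∀ k, ∃ y : R, algebraMap R K y = (q : K) ^ (k + padicValNat q k !) *
      coeff k (rescale (algebraMap R K w) (binomialSeries K ((n : K) / q))) := by
  intro k
  obtain ⟨u, hu⟩ := exists_factorial_mul_eq hq.out n k
  have hq0 : (q : K) ≠ 0 := Nat.cast_ne_zero.mpr hq.out.ne_zero
  have hC := factorial_mul_pow_mul_choose (n : K) hq0 k
  have hu' : (k ! : K) * u = (q : K) ^ (padicValNat q k !) * ∏ j ∈ range k, ((n : K) - j * q) := by
    have := congrArg (Int.cast : ℤ → K) hu
    push_cast at this
    exact this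
  have huq : (u : K) = (q : K) ^ (k + padicValNat q k !) * Ring.choose ((n : K) / q) k := by
    apply mul_left_cancel₀ (Nat.cast_ne_zero.mpr (Nat.factorial_ne_zero k) : (k ! : K) ≠ 0)
    rw [hu', ← hC]
    ring
  refine ⟨u * w ^ k, ?_⟩
  rw [coeff_rescale_binomialSeries, map_mul, map_pow, map_intCast, huq]
  ring

/-- **[Schoof2009, Proposition 12.1 (i)]**: the coefficients of `F(T) = ∏_{i∈s} (1 + w_i T)^{n_i/q}`
are integral outside `q`; precisely `q^{k + ord_q(k!)} · [T^k] F(T) ∈ R`.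
[cite: Schoof2009, Proposition 12.1 (i)] -/
theorem intOutside_prod_rescale_binomialSeries {q : ℕ} [hq : Fact q.Prime] {ι : Type*}
    (s : Finset ι) (w : ι → R) (n : ι → ℕ) :
    ∀ k, ∃ y : R, algebraMap R K y = (q : K) ^ (k + padicValNat q k !) *
      coeff k (∏ i ∈ s, rescale (algebraMap R K (w i)) (binomialSeries K ((n i : K) / q))) :=
  intOutside_prod s _ fun i _ => intOutside_rescale_binomialSeries (w i) (n i)

end Integrality

/-! ### [Schoof2009, Proposition 12.1 (ii)]: `k! q^k [T^k] F = c_k ≡ (∑ n_i w_i)^k (mod q)` -/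

section Congruence

variable {R : Type*} [CommRing R] [Algebra R K]

omit [CharZero K] in
/-- The constant series `1`: `c_k = 1, 0, 0, …`, `≡ 0^k`. [folklore] -/
theorem expCong_one (q : ℕ) :
    ∀ k, ∃ y : R, algebraMap R K y = (k ! : K) * (q : K) ^ k * coeff k (1 : K⟦X⟧) ∧
      (q : R) ∣ y - (0 : R) ^ k := by
  intro k
  rcases Nat.eq_zero_or_pos k with rfl | hk
  · exact ⟨1, by simp, by simp⟩
  · exact ⟨0, by simp [coeff_one, hk.ne'], by simp [hk.ne']⟩

/-- **[Schoof2009, Exercise 12.2]**: if `∑ a_k T^k/k!` and `∑ b_k T^k/k!` (here with the extra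
harmless factors `q^k`) have `a_k ≡ a^k`, `b_k ≡ b^k (mod q)`, then their product is `∑ c_k T^k/k!`
with `c_k = ∑ C(k,i) a_i b_{k-i} ≡ (a + b)^k (mod q)`. [cite: Schoof2009, Exercise 12.2] -/
theorem expCong_mul {q : ℕ} {S T : K⟦X⟧} {a b : R}
    (hS : ∀ k, ∃ y : R, algebraMap R K y = (k ! : K) * (q : K) ^ k * coeff k S ∧
      (q : R) ∣ y - a ^ k)
    (hT : ∀ k, ∃ y : R, algebraMap R K y = (k ! : K) * (q : K) ^ k * coeff k T ∧
      (q : R) ∣ y - b ^ k) :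
    ∀ k, ∃ y : R, algebraMap R K y = (k ! : K) * (q : K) ^ k * coeff k (S * T) ∧
      (q : R) ∣ y - (a + b) ^ k := by
  intro k
  choose yS hyS hqS using hS
  choose yT hyT hqT using hT
  refine ⟨∑ ij ∈ antidiagonal k, (k.choose ij.2 : R) * (yS ij.1 * yT ij.2), ?_, ?_⟩
  · rw [coeff_mul, mul_sum, map_sum]
    refine sum_congr rfl fun ij hij => ?_
    have hk : ij.1 + ij.2 = k := mem_antidiagonal.mp hij
    have hc : ((k.choose ij.2 : ℕ) : K) * (ij.1 ! : K) * (ij.2 ! : K) = (k ! : K) := by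
      rw [← hk]
      exact_mod_cast Nat.add_choose_mul_factorial_mul_factorial ij.1 ij.2
    rw [map_mul, map_mul, map_natCast, hyS, hyT, ← hc, ← hk]
    ring
  · rw [Nat.sum_antidiagonal_eq_sum_range_succ_mk, add_pow, ← sum_sub_distrib]
    refine dvd_sum fun i hi => ?_
    have hik : i ≤ k := Nat.lt_succ_iff.mp (mem_range.mp hi)
    have h1 : (k.choose (k - i) : R) * (yS i * yT (k - i)) - a ^ i * b ^ (k - i) * (k.choose i : ℕ) =
        (k.choose i : R) * ((yS i - a ^ i) * yT (k - i) + a ^ i * (yT (k - i) - b ^ (k - i))) := by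
      rw [Nat.choose_symm hik]
      ring
    rw [h1]
    exact dvd_mul_of_dvd_right
      (dvd_add (dvd_mul_of_dvd_left (hqS i) _) (dvd_mul_of_dvd_right (hqT (k - i)) _)) _

/-- [Schoof2009, Exercise 12.2] for finite products: bases add up. [cite: Schoof2009, Exercise 12.2] -/
theorem expCong_prod {q : ℕ} {ι : Type*} (s : Finset ι) (S : ι → K⟦X⟧) (a : ι → R)
    (hS : ∀ i ∈ s, ∀ k, ∃ y : R, algebraMap R K y = (k ! : K) * (q : K) ^ k * coeff k (S i) ∧
      (q : R) ∣ y - a i ^ k) :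
    ∀ k, ∃ y : R, algebraMap R K y = (k ! : K) * (q : K) ^ k * coeff k (∏ i ∈ s, S i) ∧
      (q : R) ∣ y - (∑ i ∈ s, a i) ^ k := by
  classical
  induction s using Finset.induction_on with
  | empty => rw [prod_empty, sum_empty]; exact expCong_one q
  | insert i s hi ih =>
    rw [prod_insert hi, sum_insert hi]
    exact expCong_mul (hS i (mem_insert_self i s)) (ih fun j hj => hS j (mem_insert_of_mem hj))

/-- **[Schoof2009, Proposition 12.1 (ii)] for one factor**:
`k! q^k [T^k] (1 + wT)^{n/q} = w^k ∏_{j<k} (n - jq) ≡ (n w)^k (mod q)`.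
[cite: Schoof2009, Proposition 12.1 (ii)] -/
theorem expCong_rescale_binomialSeries {q : ℕ} (hq : q ≠ 0) (w : R) (n : ℕ) :
    ∀ k, ∃ y : R, algebraMap R K y = (k ! : K) * (q : K) ^ k *
      coeff k (rescale (algebraMap R K w) (binomialSeries K ((n : K) / q))) ∧
      (q : R) ∣ y - ((n : R) * w) ^ k := by
  intro k
  have hq0 : (q : K) ≠ 0 := Nat.cast_ne_zero.mpr hq
  refine ⟨w ^ k * ∏ j ∈ range k, ((n : R) - j * q), ?_, ?_⟩
  · rw [coeff_rescale_binomialSeries, map_mul, map_pow, map_prod]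
    have h1 : (k ! : K) * (q : K) ^ k * ((algebraMap R K w) ^ k * Ring.choose ((n : K) / q) k) =
        (algebraMap R K w) ^ k * ((k ! : K) * (q : K) ^ k * Ring.choose ((n : K) / q) k) := by ring
    rw [h1, factorial_mul_pow_mul_choose _ hq0]
    simp only [map_sub, map_mul, map_natCast]
  · obtain ⟨c, hc⟩ := dvd_prod_range_sub_mul_sub_pow (n : R) (q : R) k
    exact ⟨w ^ k * c, by rw [mul_pow]; linear_combination w ^ k * hc⟩

/-- **[Schoof2009, Proposition 12.1 (ii)]**: the power series `F(T) = ∏_{i∈s} (1 + w_i T)^{n_i/q}`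
has the form `∑_k c_k T^k/(k! q^k)` with `c_k ∈ R` and `c_k ≡ (∑_i n_i w_i)^k (mod q R)`.
[cite: Schoof2009, Proposition 12.1 (ii)] -/
theorem expCong_prod_rescale_binomialSeries {q : ℕ} (hq : q ≠ 0) {ι : Type*} (s : Finset ι)
    (w : ι → R) (n : ι → ℕ) :
    ∀ k, ∃ y : R, algebraMap R K y = (k ! : K) * (q : K) ^ k *
      coeff k (∏ i ∈ s, rescale (algebraMap R K (w i)) (binomialSeries K ((n i : K) / q))) ∧
      (q : R) ∣ y - (∑ i ∈ s, (n i : R) * w i) ^ k :=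
  expCong_prod s _ _ fun i _ => expCong_rescale_binomialSeries hq (w i) (n i)

end Congruence

end Catalan.Plus

end Literature.NumberTheory.DiophantineGeometry
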